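/-
Copyright (c) 2026. Released under Apache 2.0 license.
-/
import Mathlib.Algebra.Order.Group.Nat
import Mathlib.Data.List.Basic
import Mathlib.Data.List.Palindrome
import HarnessLib

/-!
# Symmetries in texts: palstars and the lemma of Galil and Seiferas

A specification-level formalisation of the second half of §8.3 *Searching for symmetric words* of
Crochemore–Rytter, *Text Algorithms* (1994), over `List α`: palindromes in the book's sense
(`IsPAL`: symmetric words of length at least two, even or odd), **palstars** (`IsPalstar`: their
compositions, the language `PAL*`), `firstPal` (the book's `first1`: the length of the shortest
prefix palindrome) and `parsePal` (the book's `parse1`: the least length of a prefix palindrome whose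
removal leaves a palstar), and

* **Lemma 8.14 (Galil–Seiferas)**: for a non-empty palstar,
  `parse1(x) ∈ {first1(x), 2·first1(x) - 1, 2·first1(x) + 1}` (`parsePal_mem`; in the form the
  algorithm uses, `IsPalstar.exists_drop`: some `p` among the three candidates cuts a prefix
  palindrome off `x` leaving a palstar);
* the recogniser **`PALSTAR`** it yields (`palstarTest`, trying the three candidates recursively, with
  `palstarTest_iff : palstarTest x = true ↔ IsPalstar x`), whence `IsPalstar` is decidable and the
  book's examples `bbabb` (`parse1 = 2·first1 + 1`), `abbabba` (`parse1 = 2·first1 - 1`) and `aabab`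
  (`parse1 = first1`) are evaluated by `decide`.

The proof of Lemma 8.14 is the one the book indicates: two prefix palindromes of lengths
`f < p ≤ 2f - 2` give one of length `2f - p ∈ [2, f)` (`reverse_take_eq_of_two_prefixes`),
contradicting the minimality of `f = first1`; `p = 2f` and `p ≥ 2f + 2` split the longer one as
`u u`, resp. `u z u` with `z` a palindrome (`eq_append_of_two_prefixes`), so that `f` itself is a
parsing position; the critical lengths `2f - 1` and `2f + 1` (where `z` would have length `∓1`) are
the two exceptional values.

Not formalised here: the tables `F` and `PAL` and the linear running time (Theorem 8.15), the
on-line version, Lemma 8.16 and compositions of exactly two, three or four palindromes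
(Theorem 8.17), and `PAL_k`-palstars.  Even palstars and Manacher's radii are the subject of the
companion file `Palstars.lean` (whose `first1` is the book's `first` for EVEN palindromes).

## References

* [CrochemoreRytter1994] M. Crochemore, W. Rytter, *Text Algorithms*, Oxford University Press
  (1994), §8.3, Lemma 8.14, function `PALSTAR` and Theorem 8.15.
* Z. Galil, J. Seiferas, *A linear-time on-line recognition algorithm for
  "palstar"*, J. ACM 25 (1978) 102–111 (the source of Lemma 8.14).
* [KnuthMorrisPratt1977] D. E. Knuth, J. H. Morris, V. R. Pratt, *Fast pattern matching in
  strings*, SIAM J. Comput. 6 (1977) 323–350 — §6 (palstars, the even case).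
-/

namespace Literature.Combinatorics.Words

/-! Throughout, words are lists over a type `α` with decidable equality where algorithms are run;
positions are `0`-based and `x.take n` is the prefix of length `n` (the book's `x[1 … n]`). -/

variable {α : Type*}

/-! ### A structural least-element search (so that `decide` evaluates `first1` / `parse1`) -/

section Search

/-- Search for the least `s' ≥ s` satisfying `p` among `s, s + 1, …` with `fuel` further steps;
returns `s + fuel` on exhaustion when `p (s + fuel)` fails too. [folklore] -/
private def leastSearch (p : ℕ → Prop) [DecidablePred p] : ℕ → ℕ → ℕ
  | 0, s => s
  | fuel + 1, s => if p s then s else leastSearch p fuel (s + 1)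

/-- What the search returns: a value `≥ s`, nothing satisfying `p` strictly before it, and either
`p` holds there or it is the exhaustion value `s + fuel`. [folklore] -/
private theorem leastSearch_spec (p : ℕ → Prop) [DecidablePred p] :
    ∀ fuel s, s ≤ leastSearch p fuel s ∧
      (∀ s', s ≤ s' → s' < leastSearch p fuel s → ¬ p s') ∧
      (p (leastSearch p fuel s) ∨ leastSearch p fuel s = s + fuel)
  | 0, s => ⟨le_rfl, fun s' h1 h2 => absurd h2 (by simp [leastSearch] at *; omega),
      by by_cases h : p s <;> simp [leastSearch, h]⟩
  | fuel + 1, s => by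
    by_cases h : p s
    · simp only [leastSearch, if_pos h]
      exact ⟨le_rfl, fun s' h1 h2 => absurd h2 (by omega), Or.inl h⟩
    · simp only [leastSearch, if_neg h]
      obtain ⟨h1, h2, h3⟩ := leastSearch_spec p fuel (s + 1)
      refine ⟨by omega, fun s' hs' hlt => ?_, ?_⟩
      · rcases Nat.eq_or_lt_of_le hs' with rfl | hlt'
        · exact h
        · exact h2 s' hlt' hlt
      · rcases h3 with h3 | h3
        · exact Or.inl h3
        · exact Or.inr (by omega)

/-- `leastPos p n`: the least `s` with `1 ≤ s ≤ n` satisfying `p`, and `0` if there is none (the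
convention of the functions `first`, `first1` of Crochemore–Rytter §8.3). [folklore] -/
private def leastPos (p : ℕ → Prop) [DecidablePred p] (n : ℕ) : ℕ :=
  if leastSearch p n 1 ≤ n then leastSearch p n 1 else 0

/-- If some `s ∈ [1, n]` satisfies `p`, `leastPos p n` is the least one. [folklore] -/
private theorem leastPos_spec {p : ℕ → Prop} [DecidablePred p] {n s : ℕ} (hs1 : 1 ≤ s)
    (hsn : s ≤ n) (hp : p s) :
    1 ≤ leastPos p n ∧ leastPos p n ≤ s ∧ p (leastPos p n) ∧
      ∀ s', 1 ≤ s' → s' < leastPos p n → ¬ p s' := by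
  obtain ⟨h1, h2, h3⟩ := leastSearch_spec p n 1
  have hle : leastSearch p n 1 ≤ s := by
    by_contra h
    exact h2 s hs1 (not_le.mp h) hp
  have hn : leastSearch p n 1 ≤ n := hle.trans hsn
  simp only [leastPos, if_pos hn]
  refine ⟨h1, hle, ?_, h2⟩
  rcases h3 with h3 | h3
  · exact h3
  · omega

/-- If no `s ∈ [1, n]` satisfies `p`, `leastPos p n = 0`. [folklore] -/
private theorem leastPos_eq_zero {p : ℕ → Prop} [DecidablePred p] {n : ℕ}
    (h : ∀ s, 1 ≤ s → s ≤ n → ¬ p s) : leastPos p n = 0 := by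
  unfold leastPos
  split_ifs with hn
  · obtain ⟨h1, -, h3⟩ := leastSearch_spec p n 1
    rcases h3 with h3 | h3
    · exact absurd h3 (h _ h1 hn)
    · omega
  · rfl

/-- `leastPos p n = 0` or it is a witness in `[1, n]`. [folklore] -/
private theorem leastPos_eq_zero_or {p : ℕ → Prop} [DecidablePred p] (n : ℕ) :
    leastPos p n = 0 ∨ (1 ≤ leastPos p n ∧ leastPos p n ≤ n ∧ p (leastPos p n) ∧
      ∀ s', 1 ≤ s' → s' < leastPos p n → ¬ p s') := by
  by_cases h : ∃ s, 1 ≤ s ∧ s ≤ n ∧ p s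
  · obtain ⟨s, hs1, hsn, hp⟩ := h
    obtain ⟨a, b, c, d⟩ := leastPos_spec hs1 hsn hp
    exact Or.inr ⟨a, b.trans hsn, c, d⟩
  · push Not at h
    exact Or.inl (leastPos_eq_zero h)

end Search

/-! ### Symmetric words: two prefix palindromes -/

section Symmetric

/-- In a symmetric word the reverse of the prefix of length `m` is the suffix of length `m`. [folklore] -/
private theorem reverse_take_of_reverse_eq {w : List α} (hw : w.reverse = w) (m : ℕ) :
    (w.take m).reverse = w.drop (w.length - m) := by
  conv_lhs => rw [← hw]
  rw [List.take_reverse, List.reverse_reverse]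

/-- In a symmetric word the reverse of the suffix after `m` letters is the prefix of length
`|w| - m`. [folklore] -/
private theorem reverse_drop_of_reverse_eq {w : List α} (hw : w.reverse = w) (m : ℕ) :
    (w.drop m).reverse = w.take (w.length - m) := by
  conv_lhs => rw [← hw]
  rw [List.drop_reverse, List.reverse_reverse]

/-- A symmetric prefix of a symmetric word is also its suffix of the same length (a border). [folklore] -/
private theorem drop_eq_take_of_reverse_eq {w : List α} (hw : w.reverse = w) {m : ℕ}
    (hu : (w.take m).reverse = w.take m) : w.drop (w.length - m) = w.take m := by
  rw [← reverse_take_of_reverse_eq hw, hu]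

/-- Two symmetric prefixes of lengths `f < p ≤ 2 f`: the prefix of length `2 f - p` is symmetric
(it is a border of the shorter one, and a border of a symmetric word is symmetric). [folklore] -/
private theorem reverse_take_eq_of_two_prefixes {x : List α} {f p : ℕ} (hfp : f ≤ p)
    (hp2 : p ≤ 2 * f) (hpx : p ≤ x.length) (hf : (x.take f).reverse = x.take f)
    (hp : (x.take p).reverse = x.take p) :
    (x.take (2 * f - p)).reverse = x.take (2 * f - p) := by
  set w := x.take p with hw
  set u := x.take f with hu_def
  have hwl : w.length = p := by simp [hw, Nat.min_eq_left hpx]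
  have hul : u.length = f := by simp [hu_def]; omega
  have huw : w.take f = u := by rw [hw, List.take_take, Nat.min_eq_left hfp]
  -- `u` is a suffix of `w`: `w = t ++ u` with `|t| = p - f =: d`
  have hsuf : w.drop (p - f) = u := by
    have := drop_eq_take_of_reverse_eq hp (m := f) (by rw [huw]; exact hf)
    rwa [hwl, huw] at this
  set d := p - f with hd
  have hdf : d ≤ f := by omega
  -- `u = t ++ u.take (f - d)` where `t = w.take d`
  have hsplit : u = w.take d ++ u.take (f - d) := by
    have e1 : w = w.take d ++ u := by rw [← hsuf, List.take_append_drop]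
    have e2 : u = (w.take d ++ u).take f := by rw [← e1, huw]
    have hlt : (w.take d).length = d := by simp [hwl]; omega
    rw [List.take_append, hlt, List.take_of_length_le (by omega)] at e2
    exact e2
  -- hence `b := u.take (f - d)` is both a prefix and a suffix of `u`
  have hb : u.drop d = u.take (f - d) := by
    have e : u.take d ++ u.drop d = w.take d ++ u.take (f - d) := by
      rw [List.take_append_drop]; exact hsplit
    have hl : (u.take d).length = (w.take d).length := by simp [hul, hwl]; omega
    exact (List.append_inj e hl).2
  -- and a border of the symmetric word `u` is symmetric
  have hbrev : (u.take (f - d)).reverse = u.take (f - d) := by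
    have := reverse_take_of_reverse_eq hf (f - d)
    rw [hul, show f - (f - d) = d by omega, hb] at this
    exact this
  have e : x.take (2 * f - p) = u.take (f - d) := by
    rw [hu_def, List.take_take, show 2 * f - p = f - d by omega, Nat.min_eq_left (by omega)]
  rw [e]; exact hbrev

/-- A symmetric prefix `u` of length `f` of a symmetric word `w` of length `p ≥ 2 f`:
`w = u ++ z ++ u` with `z` symmetric. [folklore] -/
private theorem eq_append_of_two_prefixes {x : List α} {f p : ℕ} (h2f : 2 * f ≤ p)
    (hpx : p ≤ x.length) (hf : (x.take f).reverse = x.take f)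
    (hp : (x.take p).reverse = x.take p) :
    x.take p = x.take f ++ (x.drop f).take (p - 2 * f) ++ x.take f ∧
      ((x.drop f).take (p - 2 * f)).reverse = (x.drop f).take (p - 2 * f) := by
  set w := x.take p with hw
  set u := x.take f with hu_def
  set z := (x.drop f).take (p - 2 * f) with hz
  have hwl : w.length = p := by simp [hw, Nat.min_eq_left hpx]
  have hul : u.length = f := by simp [hu_def]; omega
  have hzl : z.length = p - 2 * f := by simp [hz]; omega
  -- `w = u ++ z ++ u₂` with `u₂ = w.drop (p - f)`
  have hdec : w = u ++ z ++ w.drop (p - f) := by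
    have e1 : w = w.take f ++ w.drop f := (List.take_append_drop f w).symm
    have e2 : w.drop f = (w.drop f).take (p - 2 * f) ++ (w.drop f).drop (p - 2 * f) :=
      (List.take_append_drop _ _).symm
    have huw : w.take f = u := by rw [hw, List.take_take, Nat.min_eq_left (by omega)]
    have hzw : (w.drop f).take (p - 2 * f) = z := by
      apply List.ext_getElem?
      intro i
      simp only [hz, hw, List.getElem?_take, List.getElem?_drop]
      split_ifs <;> first | rfl | omega
    rw [List.drop_drop, show f + (p - 2 * f) = p - f by omega] at e2
    rw [huw] at e1; rw [hzw] at e2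
    conv_lhs => rw [e1, e2]
    rw [List.append_assoc]
  have hu2l : (w.drop (p - f)).length = f := by simp [hwl]; omega
  -- reverse and compare blocks of equal lengths
  have hrev : (w.drop (p - f)).reverse ++ (z.reverse ++ u.reverse) = u ++ (z ++ w.drop (p - f)) := by
    have h1 := congrArg List.reverse hdec
    simp only [List.reverse_append, List.append_assoc] at h1
    rw [hp] at h1
    rw [← h1]
    exact hdec.trans (List.append_assoc _ _ _)
  obtain ⟨e1, e2⟩ := List.append_inj hrev (by rw [List.length_reverse, hu2l, hul])
  obtain ⟨e3, e4⟩ := List.append_inj e2 (by rw [List.length_reverse])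
  refine ⟨?_, e3⟩
  have hu2 : w.drop (p - f) = u := by rw [← e4, hf]
  conv_lhs => rw [hdec, hu2]

end Symmetric

/-! ### Palindromes (length at least two) and palstars -/

section Palstars

variable [DecidableEq α]

/-- A **palindrome** in the book's sense: a symmetric word of length at least two (even or odd).
[cite: CrochemoreRytter1994, §8.3 (PAL: non-trivial symmetric words)] -/
def IsPAL (w : List α) : Prop := 2 ≤ w.length ∧ w.reverse = w

/-- Palindromes are recognised letter by letter. [folklore] -/
instance (w : List α) : Decidable (IsPAL w) := by
  unfold IsPAL; infer_instance

/-- **Palstars**: compositions of palindromes (the language `PAL*`; the empty composition is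
allowed). [cite: CrochemoreRytter1994, §8.3 (palstars, PAL*)] -/
def IsPalstar (x : List α) : Prop :=
  ∃ L : List (List α), (∀ w ∈ L, IsPAL w) ∧ L.flatten = x

omit [DecidableEq α] in
/-- The empty word is a palstar (empty composition). [cite: CrochemoreRytter1994, §8.3 (PAL*)] -/
theorem isPalstar_nil : IsPalstar ([] : List α) := ⟨[], by simp, rfl⟩

omit [DecidableEq α] in
/-- A palindrome is a palstar. [cite: CrochemoreRytter1994, §8.3 (PAL*)] -/
theorem IsPAL.isPalstar {w : List α} (h : IsPAL w) : IsPalstar w :=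
  ⟨[w], by simpa using h, by simp⟩

omit [DecidableEq α] in
/-- Palstars are closed under concatenation. [cite: CrochemoreRytter1994, §8.3 (PAL*)] -/
theorem IsPalstar.append {x y : List α} (hx : IsPalstar x) (hy : IsPalstar y) :
    IsPalstar (x ++ y) := by
  obtain ⟨L, hL, rfl⟩ := hx
  obtain ⟨M, hM, rfl⟩ := hy
  refine ⟨L ++ M, fun w hw => ?_, by simp⟩
  rcases List.mem_append.mp hw with h | h
  · exact hL w h
  · exact hM w h

omit [DecidableEq α] in
/-- A non-empty palstar is non-trivially parsed: a prefix palindrome of some length `p ≥ 2`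
followed by a palstar (a *parsing position* `p`). [cite: CrochemoreRytter1994, §8.3 (function parse1)] -/
theorem IsPalstar.exists_take {x : List α} (hx : IsPalstar x) (hne : x ≠ []) :
    ∃ p, 2 ≤ p ∧ p ≤ x.length ∧ IsPAL (x.take p) ∧ IsPalstar (x.drop p) := by
  obtain ⟨L, hL, rfl⟩ := hx
  cases L with
  | nil => simp at hne
  | cons w L =>
    have hw : IsPAL w := hL w (by simp)
    refine ⟨w.length, hw.1, by simp, ?_, ?_⟩
    · simpa using hw
    · rw [List.flatten_cons, List.drop_left]
      exact ⟨L, fun v hv => hL v (by simp [hv]), rfl⟩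

/-- **`first1(x)`** of the book (here `firstPal`): the length of the shortest palindrome (length
`≥ 2`) that is a prefix of `x`, and `0` if there is none.
[cite: CrochemoreRytter1994, §8.3 (function first1)] -/
def firstPal (x : List α) : ℕ := leastPos (fun n => IsPAL (x.take n)) x.length

/-- What `firstPal` returns: `0`, or the least length of a prefix palindrome.
[cite: CrochemoreRytter1994, §8.3 (function first1)] -/
theorem firstPal_eq_zero_or (x : List α) :
    firstPal x = 0 ∨ (1 ≤ firstPal x ∧ firstPal x ≤ x.length ∧ IsPAL (x.take (firstPal x)) ∧
      ∀ n, 1 ≤ n → n < firstPal x → ¬ IsPAL (x.take n)) :=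
  leastPos_eq_zero_or (p := fun n => IsPAL (x.take n)) x.length

/-- A positive `firstPal` names a prefix palindrome. [cite: CrochemoreRytter1994, §8.3 (function first1)] -/
theorem isPAL_take_firstPal {x : List α} (h : 1 ≤ firstPal x) :
    IsPAL (x.take (firstPal x)) ∧ firstPal x ≤ x.length := by
  rcases firstPal_eq_zero_or x with h0 | ⟨_, h2, h3, _⟩
  · omega
  · exact ⟨h3, h2⟩

omit [DecidableEq α] in
/-- Lengths of prefixes. [folklore] -/
private theorem length_take_of_le {x : List α} {n : ℕ} (h : n ≤ x.length) : (x.take n).length = n := by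
  simp [h]

/-- The case analysis behind **Lemma 8.14**: if `p` is any parsing position of `x` (a prefix
palindrome of length `p` followed by a palstar) and `f = first1(x)`, then `f ≤ p`, and either
`p ∈ {f, 2f - 1, 2f + 1}` or `f` itself is a parsing position (the palstar left after the shortest
prefix palindrome).  Lengths `f < p ≤ 2f - 2` are impossible (they would give a prefix palindrome of
length `2f - p < f`), `p = 2f` splits as `u u` and `p ≥ 2f + 2` as `u z u` with `z ∈ PAL`.
[cite: CrochemoreRytter1994, §8.3 Lemma 8.14 (proof)] -/
theorem firstPal_le_and_cases_of_parsing {x : List α} {p : ℕ} (hp2 : 2 ≤ p) (hpx : p ≤ x.length)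
    (hpal : IsPAL (x.take p)) (hrest : IsPalstar (x.drop p)) :
    2 ≤ firstPal x ∧ firstPal x ≤ p ∧
      ((p = firstPal x ∨ p = 2 * firstPal x - 1 ∨ p = 2 * firstPal x + 1) ∨
        IsPalstar (x.drop (firstPal x))) := by
  have key : 1 ≤ firstPal x ∧ firstPal x ≤ p ∧ IsPAL (x.take (firstPal x)) ∧
      ∀ n, 1 ≤ n → n < firstPal x → ¬ IsPAL (x.take n) :=
    leastPos_spec (p := fun n => IsPAL (x.take n)) (by omega) hpx hpal
  obtain ⟨hf1, hfp, hfpal, hmin⟩ := key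
  set f := firstPal x with hf_def
  have hfx : f ≤ x.length := hfp.trans hpx
  have hlenf : (x.take f).length = f := length_take_of_le hfx
  have hf2 : 2 ≤ f := by have := hfpal.1; rwa [hlenf] at this
  refine ⟨hf2, hfp, ?_⟩
  rcases Nat.lt_or_ge p (2 * f) with hlt | hge
  · -- `f ≤ p < 2f`: either `p = f`, `p = 2f - 1`, or a shorter prefix palindrome exists
    by_cases hfeq : p = f
    · exact Or.inl (Or.inl hfeq)
    · by_cases hcrit : p = 2 * f - 1
      · exact Or.inl (Or.inr (Or.inl hcrit))
      · exfalso
        have hsym := reverse_take_eq_of_two_prefixes hfp hlt.le hpx hfpal.2 hpal.2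
        refine hmin (2 * f - p) (by omega) (by omega) ⟨?_, hsym⟩
        rw [length_take_of_le (by omega)]; omega
  · -- `p ≥ 2f`: `p = 2f + 1` is a candidate; otherwise `x.take p = u z u` with `z = []` or `z ∈ PAL`
    by_cases hcrit : p = 2 * f + 1
    · exact Or.inl (Or.inr (Or.inr hcrit))
    · right
      obtain ⟨hdec, hz⟩ := eq_append_of_two_prefixes hge hpx hfpal.2 hpal.2
      have e1 : x = x.take f ++ ((x.drop f).take (p - 2 * f) ++ (x.take f ++ x.drop p)) := by
        calc x = x.take p ++ x.drop p := (List.take_append_drop p x).symm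
          _ = x.take f ++ (x.drop f).take (p - 2 * f) ++ x.take f ++ x.drop p := by rw [hdec]
          _ = x.take f ++ ((x.drop f).take (p - 2 * f) ++ (x.take f ++ x.drop p)) := by
            simp only [List.append_assoc]
      have hsplit : x.drop f = (x.drop f).take (p - 2 * f) ++ (x.take f ++ x.drop p) := by
        have e2 := congrArg (List.drop f) e1
        have hnil : (x.take f).drop f = [] := by simp
        rwa [List.drop_append_of_le_length (le_of_eq hlenf.symm), hnil, List.nil_append] at e2
      rw [hsplit]
      refine IsPalstar.append ?_ (hfpal.isPalstar.append hrest)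
      by_cases hz0 : p - 2 * f = 0
      · rw [hz0, List.take_zero]; exact isPalstar_nil
      · refine IsPAL.isPalstar ⟨?_, hz⟩
        rw [List.length_take, List.length_drop]; omega

/-- **Lemma 8.14 (Galil–Seiferas), in the form the algorithm uses**: a non-empty palstar has a
prefix palindrome, and for `f = first1(x)` one of the three lengths `f`, `2f - 1`, `2f + 1` is a
parsing position — it cuts a prefix palindrome off `x` and leaves a palstar.
[cite: CrochemoreRytter1994, §8.3 Lemma 8.14] -/
theorem IsPalstar.exists_drop {x : List α} (hx : IsPalstar x) (hne : x ≠ []) :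
    2 ≤ firstPal x ∧ ∃ p, (p = firstPal x ∨ p = 2 * firstPal x - 1 ∨ p = 2 * firstPal x + 1) ∧
      p ≤ x.length ∧ IsPAL (x.take p) ∧ IsPalstar (x.drop p) := by
  obtain ⟨p, hp2, hpx, hpal, hrest⟩ := hx.exists_take hne
  obtain ⟨hf2, hfp, hcases⟩ := firstPal_le_and_cases_of_parsing hp2 hpx hpal hrest
  refine ⟨hf2, ?_⟩
  rcases hcases with hmem | hfpars
  · exact ⟨p, hmem, hpx, hpal, hrest⟩
  · have h := isPAL_take_firstPal (x := x) (by omega)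
    exact ⟨firstPal x, Or.inl rfl, h.2, h.1, hfpars⟩

/-- One step of **function `PALSTAR`**: try to cut a prefix palindrome of length `s` and recurse.
[cite: CrochemoreRytter1994, §8.3 (function PALSTAR)] -/
def palstarStep (rec : List α → Bool) (x : List α) (s : ℕ) : Bool :=
  decide (s ≤ x.length ∧ IsPAL (x.take s)) && rec (x.drop s)

/-- **Function `PALSTAR`** (Galil–Seiferas via Lemma 8.14): a non-empty word is a palstar iff, for
`f = first1(x) ≠ 0`, one of the cuts at `f`, `2f - 1`, `2f + 1` leaves a palstar; with a step
counter. [cite: CrochemoreRytter1994, §8.3 (function PALSTAR)] -/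
def palstarAux : ℕ → List α → Bool
  | 0, x => x.isEmpty
  | fuel + 1, x =>
    if x = [] then true
    else if firstPal x = 0 then false
    else palstarStep (palstarAux fuel) x (firstPal x) ||
      (palstarStep (palstarAux fuel) x (2 * firstPal x - 1) ||
        palstarStep (palstarAux fuel) x (2 * firstPal x + 1))

/-- `PALSTAR(x)`. [cite: CrochemoreRytter1994, §8.3 (function PALSTAR)] -/
def palstarTest (x : List α) : Bool := palstarAux x.length x

/-- A successful step certifies a palstar, given correctness of the recursive call. [folklore] -/
private theorem isPalstar_of_palstarStep {rec : List α → Bool} {x : List α} {s : ℕ}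
    (hrec : rec (x.drop s) = true → IsPalstar (x.drop s)) (h : palstarStep rec x s = true) :
    IsPalstar x := by
  simp only [palstarStep, Bool.and_eq_true, decide_eq_true_eq] at h
  have h' := h.1.2.isPalstar.append (hrec h.2)
  rwa [List.take_append_drop] at h'

/-- Correctness of `PALSTAR` with enough fuel. [cite: CrochemoreRytter1994, §8.3 (function PALSTAR, correctness via Lemma 8.14)] -/
theorem palstarAux_iff :
    ∀ (fuel : ℕ) (x : List α), x.length ≤ fuel → (palstarAux fuel x = true ↔ IsPalstar x)
  | 0, x, hx => by
    have h0 : x = [] := List.eq_nil_of_length_eq_zero (by omega)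
    subst h0
    simp [palstarAux, isPalstar_nil]
  | fuel + 1, x, hx => by
    by_cases h0 : x = []
    · subst h0
      simp [palstarAux, isPalstar_nil]
    · simp only [palstarAux, if_neg h0]
      by_cases hf : firstPal x = 0
      · rw [if_pos hf]
        constructor
        · intro h; exact absurd h Bool.false_ne_true
        · intro hp
          have := (hp.exists_drop h0).1
          omega
      · rw [if_neg hf]
        have hpos : 0 < x.length := List.length_pos_of_ne_nil h0
        -- the recursive calls are correct on every strict suffix `x.drop s`, `s ≥ 1`
        have hrec : ∀ s, 1 ≤ s → (palstarAux fuel (x.drop s) = true ↔ IsPalstar (x.drop s)) :=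
          fun s hs => palstarAux_iff fuel (x.drop s) (by simp only [List.length_drop]; omega)
        have hf1 : 1 ≤ firstPal x := by omega
        constructor
        · intro h
          simp only [Bool.or_eq_true] at h
          rcases h with h | h | h
          · exact isPalstar_of_palstarStep (hrec _ hf1).1 h
          · exact isPalstar_of_palstarStep (hrec _ (by omega)).1 h
          · exact isPalstar_of_palstarStep (hrec _ (by omega)).1 h
        · intro hp
          obtain ⟨hf2, p, hmem, hpx, hpal, hrest⟩ := hp.exists_drop h0
          have hstep : palstarStep (palstarAux fuel) x p = true := by
            simp only [palstarStep, Bool.and_eq_true, decide_eq_true_eq]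
            exact ⟨⟨hpx, hpal⟩, (hrec p (by omega)).2 hrest⟩
          simp only [Bool.or_eq_true]
          rcases hmem with rfl | rfl | rfl
          · exact Or.inl hstep
          · exact Or.inr (Or.inl hstep)
          · exact Or.inr (Or.inr hstep)

/-- **`PALSTAR` recognises palstars** (Galil–Seiferas; the book's function `PALSTAR`, whose linear
running time is Theorem 8.15). [cite: CrochemoreRytter1994, §8.3 (function PALSTAR / Theorem 8.15, correctness)] -/
theorem palstarTest_iff (x : List α) : palstarTest x = true ↔ IsPalstar x :=
  palstarAux_iff x.length x le_rfl

/-- Hence being a palstar is decidable (by running `PALSTAR`). [folklore] -/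
instance (x : List α) : Decidable (IsPalstar x) := decidable_of_iff _ (palstarTest_iff x)

/-- **`parse1(x)`** of the book (here `parsePal`): the least length of a prefix palindrome of `x`
whose removal leaves a palstar (`0` if there is none, i.e. if `x` is empty or not a palstar).
[cite: CrochemoreRytter1994, §8.3 (function parse1)] -/
def parsePal (x : List α) : ℕ :=
  leastPos (fun n => IsPAL (x.take n) ∧ IsPalstar (x.drop n)) x.length

/-- **Lemma 8.14 (Galil and Seiferas 1978)**: for a non-empty palstar `x`,
`parse1(x) ∈ {first1(x), 2·first1(x) - 1, 2·first1(x) + 1}`.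
[cite: CrochemoreRytter1994, §8.3 Lemma 8.14] -/
theorem parsePal_mem {x : List α} (hx : IsPalstar x) (hne : x ≠ []) :
    parsePal x = firstPal x ∨ parsePal x = 2 * firstPal x - 1 ∨ parsePal x = 2 * firstPal x + 1 := by
  obtain ⟨p, hp2, hpx, hpal, hrest⟩ := hx.exists_take hne
  have key : 1 ≤ parsePal x ∧ parsePal x ≤ p ∧
      (IsPAL (x.take (parsePal x)) ∧ IsPalstar (x.drop (parsePal x))) ∧
      ∀ n, 1 ≤ n → n < parsePal x → ¬ (IsPAL (x.take n) ∧ IsPalstar (x.drop n)) :=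
    leastPos_spec (p := fun n => IsPAL (x.take n) ∧ IsPalstar (x.drop n)) (by omega) hpx ⟨hpal, hrest⟩
  obtain ⟨hq1, hqp, ⟨hqpal, hqrest⟩, hqmin⟩ := key
  have hqx : parsePal x ≤ x.length := hqp.trans hpx
  have hq2 : 2 ≤ parsePal x := by
    have := hqpal.1; rwa [length_take_of_le hqx] at this
  obtain ⟨hf2, hfq, hcases⟩ := firstPal_le_and_cases_of_parsing hq2 hqx hqpal hqrest
  rcases hcases with hmem | hfpars
  · exact hmem
  · -- `f` is a parsing position, so the least one is `≤ f`, hence `= f`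
    left
    by_contra hne'
    have hlt : firstPal x < parsePal x := lt_of_le_of_ne hfq (Ne.symm hne')
    exact hqmin (firstPal x) (by omega) hlt ⟨(isPAL_take_firstPal (x := x) (by omega)).1, hfpars⟩

/-- The book's three examples: `bbabb` (`parse1 = 5 = 2·first1 + 1`), `abbabba`
(`parse1 = 7 = 2·first1 - 1`) and `aabab` (`parse1 = first1 = 2`) — all palstars.
[cite: CrochemoreRytter1994, §8.3 (examples before Lemma 8.14)] -/
example : (firstPal [1, 1, 0, 1, 1], parsePal [1, 1, 0, 1, 1]) = (2, 5) ∧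
    (firstPal [0, 1, 1, 0, 1, 1, 0], parsePal [0, 1, 1, 0, 1, 1, 0]) = (4, 7) ∧
    (firstPal [0, 0, 1, 0, 1], parsePal [0, 0, 1, 0, 1]) = (2, 2) := by decide

/-- `bbabb`, `abbabba` and `aabab` are palstars; `aab` is not (its only prefix palindrome is `aa`,
leaving `b`), nor is `ab`. -/
example : IsPalstar [1, 1, 0, 1, 1] ∧ IsPalstar [0, 1, 1, 0, 1, 1, 0] ∧ IsPalstar [0, 0, 1, 0, 1] ∧
    ¬ IsPalstar [0, 0, 1] ∧ ¬ IsPalstar [0, 1] := by decide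

end Palstars

end Literature.Combinatorics.Words
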